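import Summits.HubbardSuperconductivity.HubbardSuperconductivity.Theorems.AnisotropyChordTransferFibre3FinXDGM3
import Summits.HubbardSuperconductivity.HubbardSuperconductivity.Theorems.AnisotropyChordTransferFibre3FinXC2Cover

/-!
# Route `AnisotropyChord` / H0 rotor rung: the per-`L` GM₃ glue, XBC2 form (rows N₁+C from g6's `xbcCellAny2` cells, `L = 20–24`)

Copy of `…FinXDGM3` with the enclosing rows-N₁+C cell fact read in the XBC2 form `xbcCellAny2` (g6's literal-point combined cells for
`20 ≤ L ≤ 24`, soundness `FinXB.xbc2_cellAny_sound`): `gmCellOK2`, `cellsAllG2`, `gmCheck2`, `cover_allG2`, ★ `gm3_of_gmCellOK2`,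
★★★ `gm3_of_gmCheck2`.  Prover seat `hubbard-h0-rotor-p3` g7; helper for piece A = stmt-HubbardSuperconductivity-23918 of rung 19089
(`--supports`, helper class).  WHAT THIS IS NOT: nothing here proves superconductivity in the Hubbard model (rotor TARGET as worded stays
FALSE, g15 verdict); glue for ONE conditional reduction.  Tree imports only; no sorry, no new axioms.
-/

set_option linter.dupNamespace false
set_option autoImplicit false

namespace Summit.HubbardSuperconductivity.HubbardSuperconductivity.Theorems.AnisotropyChord.Transfer.Fibre3

namespace FinXD

open scoped BigOperators
open Finset Hole2 FinCell FinXB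

/-- the per-pair check: row D, side condition, nesting, and the enclosing combined `N₁`+C cell — XBC2 form (`xbcCellAny2`, L = 20–24). -/
def gmCellOK2 (L : ℕ) (d1 : ℚ) (bd : ℕ) (a : GCell) (next : ℤ) : Bool :=
  xdCellAny0 L d1 a.lam next a.aD && sdCellAnyZ L d1 bd a.lam next (a.c, a.bn, a.aD) &&
    decide (a.la ≤ a.lam) && decide (next ≤ a.lb) && xbcCellAny2 L d1 bd a.la a.lb (a.c, a.bn)

/-- all consecutive pairs pass (XBC2 form). -/
def cellsAllG2 (L : ℕ) (d1 : ℚ) (bd : ℕ) : List GCell → Bool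
  | [] => true
  | [_] => true
  | a :: b :: rest => gmCellOK2 L d1 bd a b.lam && cellsAllG2 L d1 bd (b :: rest)

/-- ★ THE PER-`L` GM₃ CERTIFICATE (XBC2 form) on `0 < Δ ≤ Δ₁`: points start at `0`, end `≥ lamTop L`, `0 < bd`, every pair passes. -/
def gmCheck2 (L : ℕ) (d1 : ℚ) (bd : ℕ) (cells : List GCell) : Bool :=
  decide ((cells.head?.map GCell.lam) = some 0) && decide (2 ≤ cells.length) && decide (lamTop L ≤ cellsLastG cells)
    && decide (0 < bd) && cellsAllG2 L d1 bd cells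

/-- chunking lemma for long certificate lists: `cellsAllG2` of `x :: (xs ++ y :: ys)` from `x :: (xs ++ [y])` and `y :: ys`
(the per-`L` assemblies prove the chunks by `simp only` with the cell facts and chain them with this, keeping terms shallow). [folklore] -/
theorem cellsAllG2_cons_append (L : ℕ) (d1 : ℚ) (bd : ℕ) {x y : GCell} {xs ys : List GCell}
    (h1 : cellsAllG2 L d1 bd (x :: (xs ++ [y])) = true) (h2 : cellsAllG2 L d1 bd (y :: ys) = true) :
    cellsAllG2 L d1 bd (x :: (xs ++ y :: ys)) = true := by
  induction xs generalizing x with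
  | nil =>
    simp only [List.nil_append, cellsAllG2, Bool.and_eq_true] at h1 ⊢
    exact ⟨h1.1, h2⟩
  | cons z zs ih =>
    simp only [List.cons_append, cellsAllG2, Bool.and_eq_true] at h1 ⊢
    exact ⟨h1.1, ih h1.2⟩

/-- the arithmetic cover: a point of `[p₀, last]` lies in some checked pair. [folklore] -/
theorem cover_allG2 (L : ℕ) (d1 : ℚ) (bd : ℕ) : ∀ (rest : List GCell) (a b : GCell) (x : ℝ),
    cellsAllG2 L d1 bd (a :: b :: rest) = true → (a.lam : ℝ) ≤ x → x ≤ ((cellsLastG (a :: b :: rest) : ℤ) : ℝ) →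
    ∃ g : GCell, ∃ nx : ℤ, gmCellOK2 L d1 bd g nx = true ∧ (g.lam : ℝ) ≤ x ∧ x ≤ (nx : ℝ) := by
  intro rest
  induction rest with
  | nil =>
    intro a b x h hax hxl
    simp only [cellsAllG2, Bool.and_true] at h
    exact ⟨a, b.lam, h, hax, by simpa [cellsLastG] using hxl⟩
  | cons c rest ih =>
    intro a b x h hax hxl
    rw [show cellsAllG2 L d1 bd (a :: b :: c :: rest) = (gmCellOK2 L d1 bd a b.lam && cellsAllG2 L d1 bd (b :: c :: rest)) from rfl,
      Bool.and_eq_true] at h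
    obtain ⟨h1, h2⟩ := h
    by_cases hxb : x ≤ (b.lam : ℝ)
    · exact ⟨a, b.lam, h1, hax, hxb⟩
    · have hbx : (b.lam : ℝ) ≤ x := le_of_lt (lt_of_not_ge hxb)
      have hl : cellsLastG (a :: b :: c :: rest) = cellsLastG (b :: c :: rest) := rfl
      rw [hl] at hxl
      exact ih b c x h2 hbx hxl

/-- ★ one GM₃ pair: the ground profile with `λ₂·D ∈ [g.lam, nx]` yields `GM3Fibre L Δ` (`9 ≤ L`, `0 < Δ ≤ Δ₁ < 1`). [folklore] -/
theorem gm3_of_gmCellOK2 (L : ℕ) [NeZero L] (hL : 9 ≤ L) {d1 : ℚ} {bd : ℕ} (hbd : 0 < bd) {Δ lam2 : ℝ}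
    (hΔ0 : 0 < Δ) (hΔd : Δ ≤ (d1 : ℝ)) (hΔ1 : Δ < 1) {f : Tor L → ℝ} (hf : IsGroundTwoMagnon L Δ lam2 f)
    {g : GCell} {nx : ℤ} (hok : gmCellOK2 L d1 bd g nx = true)
    (hlo : (g.lam : ℝ) ≤ lam2 * ((D : ℤ) : ℝ)) (hhi : lam2 * ((D : ℤ) : ℝ) ≤ (nx : ℝ)) : GM3Fibre L Δ := by
  have hL5 : 5 ≤ L := by omega
  unfold gmCellOK2 at hok
  simp only [Bool.and_eq_true, decide_eq_true_eq] at hok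
  obtain ⟨⟨⟨⟨hD', hS⟩, hla⟩, hlb⟩, hC⟩ := hok
  have hla' : (g.la : ℝ) ≤ lam2 * ((D : ℤ) : ℝ) := (by exact_mod_cast hla : (g.la : ℝ) ≤ g.lam).trans hlo
  have hlb' : lam2 * ((D : ℤ) : ℝ) ≤ (g.lb : ℝ) := hhi.trans (by exact_mod_cast hlb)
  -- the three cell facts at THIS ground profile
  have hrowD := xd_cellAny_sound L hL hΔ0 hΔd hΔ1 hf hlo hhi hD'
  obtain ⟨hm, hside⟩ := sdz_cellAny_sound L hL5 hΔ0 hΔd hΔ1 hf hlo hhi hS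
  have hCC := xbc2_cellAny_sound L hL5 hΔ0 hΔd hΔ1 hf hla' hlb' hC
  -- every ground profile at `Δ` is this one
  have huniq : ∀ lam2' : ℝ, ∀ f' : Tor L → ℝ, IsGroundTwoMagnon L Δ lam2' f' → lam2' = lam2 ∧ f' = f := by
    intro lam2' f' hf'
    have hl : lam2' = lam2 := ground_lam2_unique L (by omega) hf' hf
    subst hl
    exact ⟨rfl, by rw [ground_eq_explicit L hL5 hΔ0.le hΔ1 hf', ground_eq_explicit L hL5 hΔ0.le hΔ1 hf]⟩
  -- the three cruxes at `Δ`
  have hKT1 : TrialGapAbs L Δ g.c := by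
    intro lam2' f' hf'
    obtain ⟨rfl, rfl⟩ := huniq lam2' f' hf'
    exact hCC.1
  have hKT2a : LowShellGFormAbs L Δ g.aD := by
    intro lam2' f' hf'
    obtain ⟨rfl, rfl⟩ := huniq lam2' f' hf'
    exact hrowD
  have hbdR : (0 : ℝ) < bd := by exact_mod_cast hbd
  have hKT2b : OffPoleTailAbs L Δ ((g.bn : ℝ) / bd) := by
    refine KT2Assembly.offPoleTailAbs_of_brackets L (by omega) hΔ1 (by positivity) ?_
    intro lam2' f' hf'
    obtain ⟨rfl, rfl⟩ := huniq lam2' f' hf'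
    exact hCC.2
  -- assemble
  have hT2 := Tplus_lt_of_mHole_nonneg L (by omega) hm
  have hside' : facMI L Δ f * etaEff L lam2 * ((g.aD : ℝ) + ((g.bn : ℝ) / bd) / (2 + Real.cos (2 * Real.pi / L))) < (g.c : ℝ) := by
    simpa using hside
  exact gm3_closedRho_twoHoleGap L (by omega) hΔ0 hΔ1 (g.c : ℝ) (g.aD : ℝ) ((g.bn : ℝ) / bd)
    (Hole2.twoHoleGap_threeQuarter L hL) hf hT2 hm hside' hKT1 hKT2a hKT2b

/-- ★★★ **GM₃ AT THIS `L` FROM THE KERNEL CELL FACTS**: `gmCheck L Δ₁ bd cells = true` (`9 ≤ L`) ⟹ `GM3Fibre L Δ` for every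
`0 < Δ ≤ Δ₁`, `Δ < 1` — the `K₁` three-magnon gap above the one-magnon branch dominates the `K = 0` three-magnon gap. -/
theorem gm3_of_gmCheck2 (L : ℕ) [NeZero L] (hL : 9 ≤ L) {d1 : ℚ} {bd : ℕ} {cells : List GCell}
    (h : gmCheck2 L d1 bd cells = true) {Δ : ℝ} (hΔ0 : 0 < Δ) (hΔd : Δ ≤ (d1 : ℝ)) (hΔ1 : Δ < 1) : GM3Fibre L Δ := by
  obtain ⟨lam2, f, hf⟩ := exists_ground L (by omega) Δ
  have hD := D_pos
  unfold gmCheck2 at h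
  simp only [Bool.and_eq_true, decide_eq_true_eq] at h
  obtain ⟨⟨⟨⟨hhead, hlen⟩, htop⟩, hbd⟩, hok⟩ := h
  obtain ⟨a, b, rest, hcells⟩ : ∃ a b : GCell, ∃ rest : List GCell, cells = a :: b :: rest := by
    match cells, hlen with
    | a :: b :: rest, _ => exact ⟨a, b, rest, rfl⟩
  subst hcells
  have ha0 : a.lam = 0 := by simpa using hhead
  -- the window of the ground `λ₂`
  have hwin := forall_ground_of_window_7 L (by omega) hΔ0.le hΔ1
    (fun lam2' (f' : Tor L → ℝ) => lam2' = lam2 → GM3Fibre L Δ) ?_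
  · exact hwin lam2 f hf rfl
  intro lam2' f' hf' hlam0 hlamle hEq
  subst hEq
  set x : ℝ := lam2' * ((D : ℤ) : ℝ) with hx
  have hx0 : (a.lam : ℝ) ≤ x := by rw [ha0, hx]; push_cast; positivity
  have hxtop : x ≤ ((cellsLastG (a :: b :: rest) : ℤ) : ℝ) :=
    (lam_mul_D_le_lamTop L (by omega) hlamle).trans (by exact_mod_cast htop)
  obtain ⟨g, nx, hcell, hgx, hxn⟩ := cover_allG2 L d1 bd rest a b x hok hx0 hxtop
  exact gm3_of_gmCellOK2 L hL hbd hΔ0 hΔd hΔ1 hf' hcell hgx hxn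

end FinXD

end Summit.HubbardSuperconductivity.HubbardSuperconductivity.Theorems.AnisotropyChord.Transfer.Fibre3
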